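import Mathlib
import Summits.Ventures.PercRepro2.Defs
import Summits.Ventures.PercRepro2.Independence
import Summits.Ventures.PercRepro2.Harris
import Summits.Ventures.PercRepro2.Graph
import Summits.Ventures.PercRepro2.Exploration
import Summits.Ventures.PercRepro2.Events
import Summits.Ventures.PercRepro2.Induced
import Summits.Ventures.PercRepro2.BoxUnionDefs
import Summits.Ventures.PercRepro2.BoxUnion
import Summits.Ventures.PercRepro2.BoxUnionPair
import Summits.Ventures.PercRepro2.CondAvoidPA
import Summits.Ventures.PercRepro2.PairTP2
import Summits.Ventures.PercRepro2.PairTP2Main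
import Summits.Ventures.PercRepro2.SeparatedDefs

/-!
# (PAIR-TP2), the non-interfaced half, in the kernel (blind cell PercRepro2, mine-1 g38;
proofs/MINE1-PAIRTP2.md §2, Case A)

If `u` and `v` lie in different components of `G − {s, t}`, then on `{s ↮ t}` the status of
`u` is a function of the edges touching `comp u`, the status of `v` a function of the edges
touching `comp v`, and `{s ↮ t}` itself is the intersection of three events on the three
disjoint edge groups (`SeparatedDefs.lean`).  Independence of events on disjoint edge sets
(`prob_inter_eq_mul_of_dependsOn`) then makes the grid masses `M[a,b] = P(code u = a, code v = b,
s ↮ t)` of RANK ONE: `M[a,b] · P(s ↮ t) = P(code u = a, s ↮ t) · P(code v = b, s ↮ t)`, and a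
rank-one nonnegative function on a product of chains is log-supermodular.  Together with
`PairTP2Main.pairLaw_lsm_of_not_linkable` this gives the full (⟸) direction of (PAIR-TP2) in the
kernel (`pairLaw_lsm_of_not_linkable_or_not_interfaced`).
-/

namespace Summit.Ventures.PercRepro2

namespace PairTP2

open Finset Separated
open scoped Classical

/-! ### The three edge groups and the localised events -/

section Localised

variable {V : Type*} {E : Type*} (ends : E → Sym2 V) (s t u v : V)

/-- `{s ↮ t}` in the restriction to the edges touching `comp u`. -/
def QK : Set (Config E) := {ω | ¬ Conn ends (restrictK ends (comp ends s t u) ω) s t}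

/-- `{s ↮ t}` in the restriction to the remaining edges (off `comp u` and `comp v`). -/
def QR : Set (Config E) :=
  {ω | ¬ Conn ends
    (restrict (touches ends (comp ends s t u) ∪ touches ends (comp ends s t v))ᶜ ω) s t}

/-- `QK` depends on the edges touching `comp u`. -/
lemma dependsOn_QK : DependsOn (· ∈ QK ends s t u) (touches ends (comp ends s t u)) := by
  unfold QK restrictK
  exact @dependsOn_restrict E (touches ends (comp ends s t u)) (fun a => Classical.propDecidable _)
    (fun ω' => ¬ Conn ends ω' s t)

/-- `QR` depends on the remaining edges. -/
lemma dependsOn_QR : DependsOn (· ∈ QR ends s t u v)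
    (touches ends (comp ends s t u) ∪ touches ends (comp ends s t v))ᶜ := by
  unfold QR
  exact dependsOn_restrict _ (fun ω' => ¬ Conn ends ω' s t)

/-- `{s ↮ t}` is the intersection of the three localised events. -/
lemma compl_connEvent_eq (hu : u ∉ ({s, t} : Set V)) (hv : v ∉ ({s, t} : Set V))
    (hvu : v ∉ comp ends s t u) :
    (connEvent ends s t)ᶜ = QK ends s t u ∩ QK ends s t v ∩ QR ends s t u v := by
  ext ω
  simp only [Set.mem_compl_iff, Set.mem_inter_iff, QK, QR, Set.mem_setOf_eq]
  change ¬ Conn ends ω s t ↔ _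
  rw [conn_st_iff hu hv hvu ω]
  simp only [not_or, and_assoc]

end Localised

variable {V : Type*} {E : Type*} [Fintype V] [DecidableEq V] [Fintype E] [DecidableEq E]
variable (ends : E → Sym2 V) (s t u v : V)

/-- `{code u = a}` computed in the restriction to the edges touching `comp u`. -/
def codeEvK (a : Fin 3) : Set (Config E) :=
  {ω | code ends s t (restrictK ends (comp ends s t u) ω) u = a}

omit [DecidableEq E] in
/-- `codeEvK` depends on the edges touching `comp u`. -/
lemma dependsOn_codeEvK (a : Fin 3) :
    DependsOn (· ∈ codeEvK ends s t u a) (touches ends (comp ends s t u)) := by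
  unfold codeEvK restrictK
  exact @dependsOn_restrict E (touches ends (comp ends s t u)) (fun a => Classical.propDecidable _)
    (fun ω' => code ends s t ω' u = a)

omit [Fintype V] [DecidableEq V] [Fintype E] [DecidableEq E] in
/-- The edge groups of two different components are disjoint. -/
lemma disjoint_touches_comp (hu : u ∉ ({s, t} : Set V)) (hv : v ∉ ({s, t} : Set V))
    (hvu : v ∉ comp ends s t u) :
    Disjoint (touches ends (comp ends s t u)) (touches ends (comp ends s t v)) := by
  rw [Set.disjoint_left]
  rintro e ⟨a, haK, b, hab⟩ ⟨c, hcK', d, hcd⟩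
  have hdisj := comp_disjoint (ends := ends) hvu
  rw [hab, Sym2.eq_iff] at hcd
  rcases hcd with ⟨rfl, rfl⟩ | ⟨rfl, rfl⟩
  · exact Set.disjoint_left.1 hdisj haK hcK'
  · exact Set.disjoint_left.1 hdisj haK
      (mem_comp_of_adj hv hcK' (comp_subset hu haK) (by rw [hab, Sym2.eq_swap]))

omit [DecidableEq E] in
/-- On `{s ↮ t}` the code of `u` is its code in the restriction to the edges touching `comp u`. -/
lemma code_eq_code_restrictK (hu : u ∉ ({s, t} : Set V)) {ω : Config E}
    (hQ : ω ∈ (connEvent ends s t)ᶜ) :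
    code ends s t ω u = code ends s t (restrictK ends (comp ends s t u) ω) u := by
  have hQ' : ¬ Conn ends ω s t := hQ
  have e1 := conn_iff_conn_restrictK (ends := ends) hu hQ'
  have e2 := conn_t_iff_conn_restrictK (ends := ends) hu hQ'
  unfold code
  by_cases h1 : Conn ends ω s u
  · rw [if_pos h1, if_pos (e1.1 h1)]
  · rw [if_neg h1, if_neg (fun h => h1 (e1.2 h))]
    by_cases h2 : Conn ends ω t u
    · rw [if_pos h2, if_pos (e2.1 h2)]
    · rw [if_neg h2, if_neg (fun h => h2 (e2.2 h))]

omit [DecidableEq E] in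
/-- The grid event as a product of localised events. -/
lemma gridEvent_eq_localised (hu : u ∉ ({s, t} : Set V)) (hv : v ∉ ({s, t} : Set V))
    (hvu : v ∉ comp ends s t u) (a b : Fin 3) :
    gridEvent ends s t u v (a, b) =
      (codeEvK ends s t u a ∩ QK ends s t u) ∩ (codeEvK ends s t v b ∩ QK ends s t v) ∩
        QR ends s t u v := by
  ext ω
  rw [mem_gridEvent]
  by_cases hQ : ω ∈ (connEvent ends s t)ᶜ
  · have h3 : ω ∈ QK ends s t u ∩ QK ends s t v ∩ QR ends s t u v := by
      rw [← compl_connEvent_eq ends s t u v hu hv hvu]; exact hQ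
    have hvu' : u ∉ comp ends s t v := fun h => hvu (conn_symm h)
    simp only [Set.mem_inter_iff, codeEvK, Set.mem_setOf_eq, hQ, and_true]
    rw [← code_eq_code_restrictK ends s t u hu hQ, ← code_eq_code_restrictK ends s t v hv hQ]
    constructor
    · rintro ⟨ha, hb⟩; exact ⟨⟨⟨ha, h3.1.1⟩, ⟨hb, h3.1.2⟩⟩, h3.2⟩
    · rintro ⟨⟨⟨ha, -⟩, ⟨hb, -⟩⟩, -⟩; exact ⟨ha, hb⟩
  · constructor
    · intro h; exact absurd h.2.2 hQ
    · rintro ⟨⟨⟨-, h1⟩, ⟨-, h2⟩⟩, h3⟩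
      exfalso; apply hQ
      rw [compl_connEvent_eq ends s t u v hu hv hvu]; exact ⟨⟨h1, h2⟩, h3⟩

omit [DecidableEq E] in
/-- `{code u = a} ∩ {s ↮ t}` as a product of localised events. -/
lemma codeEvent_u_eq_localised (hu : u ∉ ({s, t} : Set V)) (hv : v ∉ ({s, t} : Set V))
    (hvu : v ∉ comp ends s t u) (a : Fin 3) :
    {ω | code ends s t ω u = a} ∩ (connEvent ends s t)ᶜ =
      (codeEvK ends s t u a ∩ QK ends s t u) ∩ QK ends s t v ∩ QR ends s t u v := by
  ext ω
  by_cases hQ : ω ∈ (connEvent ends s t)ᶜ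
  · have h3 : ω ∈ QK ends s t u ∩ QK ends s t v ∩ QR ends s t u v := by
      rw [← compl_connEvent_eq ends s t u v hu hv hvu]; exact hQ
    simp only [Set.mem_inter_iff, codeEvK, Set.mem_setOf_eq, hQ, and_true]
    rw [← code_eq_code_restrictK ends s t u hu hQ]
    constructor
    · intro ha; exact ⟨⟨⟨ha, h3.1.1⟩, h3.1.2⟩, h3.2⟩
    · rintro ⟨⟨⟨ha, -⟩, -⟩, -⟩; exact ha
  · constructor
    · intro h; exact absurd h.2 hQ
    · rintro ⟨⟨⟨-, h1⟩, h2⟩, h3⟩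
      exfalso; apply hQ
      rw [compl_connEvent_eq ends s t u v hu hv hvu]; exact ⟨⟨h1, h2⟩, h3⟩

omit [DecidableEq E] in
/-- `{code v = b} ∩ {s ↮ t}` as a product of localised events. -/
lemma codeEvent_v_eq_localised (hu : u ∉ ({s, t} : Set V)) (hv : v ∉ ({s, t} : Set V))
    (hvu : v ∉ comp ends s t u) (b : Fin 3) :
    {ω | code ends s t ω v = b} ∩ (connEvent ends s t)ᶜ =
      QK ends s t u ∩ (codeEvK ends s t v b ∩ QK ends s t v) ∩ QR ends s t u v := by
  ext ω
  by_cases hQ : ω ∈ (connEvent ends s t)ᶜ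
  · have h3 : ω ∈ QK ends s t u ∩ QK ends s t v ∩ QR ends s t u v := by
      rw [← compl_connEvent_eq ends s t u v hu hv hvu]; exact hQ
    simp only [Set.mem_inter_iff, codeEvK, Set.mem_setOf_eq, hQ, and_true]
    rw [← code_eq_code_restrictK ends s t v hv hQ]
    constructor
    · intro hb; exact ⟨⟨h3.1.1, ⟨hb, h3.1.2⟩⟩, h3.2⟩
    · rintro ⟨⟨-, ⟨hb, -⟩⟩, -⟩; exact hb
  · constructor
    · intro h; exact absurd h.2 hQ
    · rintro ⟨⟨h1, ⟨-, h2⟩⟩, h3⟩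
      exfalso; apply hQ
      rw [compl_connEvent_eq ends s t u v hu hv hvu]; exact ⟨⟨h1, h2⟩, h3⟩

/-! ### Independence and the rank-one structure -/

variable {p : E → ℝ}

omit [Fintype V] [DecidableEq V] in
/-- Three events on the three edge groups are independent. -/
lemma prob_three (hu : u ∉ ({s, t} : Set V)) (hv : v ∉ ({s, t} : Set V))
    (hvu : v ∉ comp ends s t u) {A B C : Set (Config E)}
    (hA : DependsOn (· ∈ A) (touches ends (comp ends s t u)))
    (hB : DependsOn (· ∈ B) (touches ends (comp ends s t v)))
    (hC : DependsOn (· ∈ C) (touches ends (comp ends s t u) ∪ touches ends (comp ends s t v))ᶜ) :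
    prob p (A ∩ B ∩ C) = prob p A * prob p B * prob p C := by
  rw [prob_inter_eq_mul_of_dependsOn p disjoint_compl_right (dependsOn_inter hA hB) hC,
    prob_inter_eq_mul_of_dependsOn p (disjoint_touches_comp ends s t u v hu hv hvu) hA hB]

/-- **Rank one**: `M[a,b] · P(s ↮ t) = P(code u = a, s ↮ t) · P(code v = b, s ↮ t)`. -/
theorem rank_one (hu : u ∉ ({s, t} : Set V)) (hv : v ∉ ({s, t} : Set V))
    (hvu : v ∉ comp ends s t u) (a b : Fin 3) :
    prob p (gridEvent ends s t u v (a, b)) * prob p (connEvent ends s t)ᶜ =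
      prob p ({ω | code ends s t ω u = a} ∩ (connEvent ends s t)ᶜ) *
        prob p ({ω | code ends s t ω v = b} ∩ (connEvent ends s t)ᶜ) := by
  have hAQ : ∀ a, DependsOn (· ∈ codeEvK ends s t u a ∩ QK ends s t u)
      (touches ends (comp ends s t u)) := fun a => by
    have := dependsOn_inter (dependsOn_codeEvK ends s t u a) (dependsOn_QK ends s t u)
    rwa [Set.union_self] at this
  have hBQ : ∀ b, DependsOn (· ∈ codeEvK ends s t v b ∩ QK ends s t v)
      (touches ends (comp ends s t v)) := fun b => by
    have := dependsOn_inter (dependsOn_codeEvK ends s t v b) (dependsOn_QK ends s t v)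
    rwa [Set.union_self] at this
  have e1 : prob p (gridEvent ends s t u v (a, b)) =
      prob p (codeEvK ends s t u a ∩ QK ends s t u) * prob p (codeEvK ends s t v b ∩ QK ends s t v) *
        prob p (QR ends s t u v) := by
    rw [gridEvent_eq_localised ends s t u v hu hv hvu]
    exact prob_three ends s t u v hu hv hvu (hAQ a) (hBQ b) (dependsOn_QR ends s t u v)
  have e2 : prob p ({ω | code ends s t ω u = a} ∩ (connEvent ends s t)ᶜ) =
      prob p (codeEvK ends s t u a ∩ QK ends s t u) * prob p (QK ends s t v) *
        prob p (QR ends s t u v) := by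
    rw [codeEvent_u_eq_localised ends s t u v hu hv hvu]
    exact prob_three ends s t u v hu hv hvu (hAQ a) (dependsOn_QK ends s t v)
      (dependsOn_QR ends s t u v)
  have e3 : prob p ({ω | code ends s t ω v = b} ∩ (connEvent ends s t)ᶜ) =
      prob p (QK ends s t u) * prob p (codeEvK ends s t v b ∩ QK ends s t v) *
        prob p (QR ends s t u v) := by
    rw [codeEvent_v_eq_localised ends s t u v hu hv hvu]
    exact prob_three ends s t u v hu hv hvu (dependsOn_QK ends s t u) (hBQ b)
      (dependsOn_QR ends s t u v)
  have e4 : prob p (connEvent ends s t)ᶜ =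
      prob p (QK ends s t u) * prob p (QK ends s t v) * prob p (QR ends s t u v) := by
    rw [compl_connEvent_eq ends s t u v hu hv hvu]
    exact prob_three ends s t u v hu hv hvu (dependsOn_QK ends s t u) (dependsOn_QK ends s t v)
      (dependsOn_QR ends s t u v)
  rw [e1, e2, e3, e4]
  ring

/-- On a chain, `f a · f a' = f (a ⊓ a') · f (a ⊔ a')`. -/
lemma mul_min_max (f : Fin 3 → ℝ) (a a' : Fin 3) : f a * f a' = f (min a a') * f (max a a') := by
  rcases le_total a a' with h | h
  · rw [min_eq_left h, max_eq_right h]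
  · rw [min_eq_right h, max_eq_left h, mul_comm]

/-- **(PAIR-TP2), the non-interfaced half, in the kernel**: if `u`, `v` lie in different
components of `G − {s, t}`, the two-vertex status law is log-supermodular on the (Z)-lattice
for every weight vector. -/
theorem pairLaw_lsm_of_not_interfaced (hne : u ≠ v) (hu : u ∉ ({s, t} : Set V))
    (hv : v ∉ ({s, t} : Set V)) (hvu : v ∉ comp ends s t u) (hp : IsProbVec p)
    (x y : BoxUnionPair.ZLat V) :
    BoxUnionPair.pairLaw p ends {u, v} s t x * BoxUnionPair.pairLaw p ends {u, v} s t y ≤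
      BoxUnionPair.pairLaw p ends {u, v} s t (x ⊓ y) *
        BoxUnionPair.pairLaw p ends {u, v} s t (x ⊔ y) := by
  refine pairLaw_lsm_of_grid ends s t hne hp (fun k k' => ?_) x y
  obtain ⟨a, b⟩ := k
  obtain ⟨a', b'⟩ := k'
  simp only [mass_eq ends s t hne]
  change prob p (gridEvent ends s t u v (a, b)) * prob p (gridEvent ends s t u v (a', b')) ≤
    prob p (gridEvent ends s t u v (min a a', min b b')) *
      prob p (gridEvent ends s t u v (max a a', max b b'))
  set q := prob p (connEvent ends s t)ᶜ with hq
  set α : Fin 3 → ℝ := fun a => prob p ({ω | code ends s t ω u = a} ∩ (connEvent ends s t)ᶜ)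
    with hα
  set β : Fin 3 → ℝ := fun b => prob p ({ω | code ends s t ω v = b} ∩ (connEvent ends s t)ᶜ)
    with hβ
  have hr : ∀ a b, prob p (gridEvent ends s t u v (a, b)) * q = α a * β b :=
    fun a b => rank_one ends s t u v hu hv hvu a b
  by_cases hq0 : q = 0
  · have hz : ∀ a b, prob p (gridEvent ends s t u v (a, b)) = 0 := by
      intro a b
      refine le_antisymm ?_ (prob_nonneg hp _)
      rw [← hq0]
      exact prob_mono hp (fun ω h => h.2)
    rw [hz, hz, hz, hz]
  · have hM : ∀ a b, prob p (gridEvent ends s t u v (a, b)) = α a * β b / q := by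
      intro a b
      rw [eq_div_iff hq0]
      exact hr a b
    rw [hM, hM, hM, hM]
    apply le_of_eq
    rw [div_mul_div_comm, div_mul_div_comm]
    congr 1
    rw [mul_mul_mul_comm, mul_min_max α a a', mul_min_max β b b']
    ring

/-- **(PAIR-TP2), the (⟸) direction, in the kernel**: for `u ≠ v` not terminals, if `(u, v)` is
not linkable OR `u, v` lie in different components of `G − {s, t}`, the two-vertex status law
is log-supermodular on the (Z)-lattice for every weight vector. -/
theorem pairLaw_lsm_of_not_linkable_or_not_interfaced (hne : u ≠ v) (hu : u ∉ ({s, t} : Set V))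
    (hv : v ∉ ({s, t} : Set V)) (h : NotLinkable ends s t u v ∨ v ∉ comp ends s t u)
    (hp : IsProbVec p) (x y : BoxUnionPair.ZLat V) :
    BoxUnionPair.pairLaw p ends {u, v} s t x * BoxUnionPair.pairLaw p ends {u, v} s t y ≤
      BoxUnionPair.pairLaw p ends {u, v} s t (x ⊓ y) *
        BoxUnionPair.pairLaw p ends {u, v} s t (x ⊔ y) := by
  rcases h with h | h
  · exact pairLaw_lsm_of_not_linkable ends s t hne hp h x y
  · exact pairLaw_lsm_of_not_interfaced ends s t u v hne hu hv h hp x y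

end PairTP2

end Summit.Ventures.PercRepro2
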